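import Summits.QuantumFields.BalabanUV.T4Continuum.Support.SubstrateTransporterSpeciesHolo
import Mathlib.Analysis.Analytic.Constructions
import Mathlib.Analysis.Analytic.Composition
import Mathlib.Analysis.Analytic.Linear
import Mathlib.Analysis.Calculus.FDeriv.Analytic

/-!
# SUBSTRATE — ANALYTICITY (power series) OF THE TWO-SIDED COVARIANCE SPECIES ALONG THE EXPONENTIAL CHART: every entry of
# `unitCovT ∕ covAtT` read along the tower chart is `AnalyticOnNhd ℂ` on the regular set — the upgrade of `SubstrateTransporterSpeciesHolo`
# (p221143, `DifferentiableOn ℂ`) that node U2's class `T4BetaReadOutLipschitz.Probes.Analytic` asks (S-HOLO-AN ∕ S-PROBE, MAP v0.5 §4 p1)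

Cell `pub-balaban`, SUBSTRATE cell, seat `b2b-balaban-substrate-p1` (gen 2).  Summits-side under the LEAN PLACEMENT RULE.  HONEST FRAMING:
rung (B)+1 of the FINITE-VOLUME T⁴ programme — NOT infinite volume, NOT a mass gap, NOT Clay; spine PROVED 0∕9; NE4 ∕ NE9 NOT proved.
CALCULUS ONLY, NO estimate, NO radius.  WHY a second file: NE9's `analyticClass` is made of `DifferentiableOn ℂ` (served by p221143), but
NE4's read-out class `Probes.Analytic α` is made of `AnalyticOnNhd ℂ` on a ball of the MULTI-dimensional chart space, and Mathlib upgrades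
ℂ-differentiability to analyticity only in ONE variable (`DifferentiableOn.analyticOnNhd` for `f : ℂ → E`; no Hartogs ∕ Osgood in MATHLIB —
the TREE has Osgood: `Literature.Analysis.Complex.SCV.analyticOnNhd_of_differentiableOn` (`[FiniteDimensional ℂ E]`, `OsgoodProofs`) gives §4 below
from p221143 in one line each (located remark R-ne9leaf07g12-1 ∕ F-ne5leaf04g7-1); §1–§3 stay the POINTWISE `AnalyticAt` API for non-open loci and
infinite-dimensional parameter spaces).  So the chain of p221143 is re-run with `AnalyticAt ℂ`: entries, products, `Ring.inverse` at units
(`analyticAt_inverse`), the matrix exponential (`NormedSpace.exp_analytic`), sums ∕ constants — all Mathlib; the regular set, its openness and its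
centre are p221143's BY NAME.  Printed
warrant for the READING (KIND only, nothing asserted): [Balaban1987RG1] (1.17)–(1.18) p. 263 «defined and analytic on the space U^c_j(X, α₀,
α₁)», (4.4) p. 281; [Balaban1985BackgroundPropagators] Sect. B pp. 399–400.  Norm of record: Q-S13 (scope `Matrix.Norms.L2Operator`).
HONEST DEPENDENCY (cell line, verbatim): continuum YM on T⁴ ⇐ BetaPertH ∧ nine spine estimates (0/9 proved); BetaPertH ⇐ (D1) ∧ (D4) ∧
CAP+tail; G-an2-4 gates asym, D1 and NE2/3/4.

WHAT.  §1 `cle_comp_analyticAt_iff`, **`analyticAt_matrix_iff`** (a matrix map is analytic at a point iff every entry is), `analyticAt_matrix_mul`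
(any shapes), `analyticAt_matrix_inv` (at a point where `det` is a unit).  §2 the one-level species at a point along pointwise-analytic data:
`analyticAt_transport ∕ _transportA ∕ _siteMul ∕ _covDc ∕ _covDcA ∕ _covLapT ∕ _Qcov ∕ _QcovA ∕ _deltaQT ∕ _greenT ∕ _unitCovT`.  §3 the chart:
`analyticAt_mexp ∕ _coord ∕ _expChart ∕ _expChartInv`, tower `analyticAt_expChartT_apply ∕ _expChartInvT_apply`.  §4 ANALYTICITY OF RECORD:
`analyticAt_deltaQT_expChartT` (everywhere), `analyticOnNhd_unitCovT_expChartT` (on `regularSetAt`), **`analyticOnNhd_covAtT_expChart`** (every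
level ∕ slot ∕ entry, on `regularSet`), **`exists_ball_analyticOnNhd_covAtT`** (`0 ∈ regularSet` ⇒ a ball `ball 0 ρ` of analyticity — the shape of
`Probes.Analytic`; ρ from openness, NOT computed).  Imports p221143 + Mathlib analytic calculus; modifies nothing.
-/

noncomputable section

open scoped BigOperators Matrix Kronecker ComplexConjugate Matrix.Norms.L2Operator

namespace Summit.QuantumFields.BalabanUV.T4Continuum.SubstrateTransporterSpeciesAnalytic

open Literature.MathematicalPhysics.QuantumFieldTheory.Balaban1983to89
open Literature.MathematicalPhysics.QuantumFieldTheory.Balaban1983to89.B5Prop11Plancherel (Tor fine)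
open Literature.MathematicalPhysics.QuantumFieldTheory.Balaban1983to89.B5G183RateUnitTower (lev lev_neZero)
open Summit.QuantumFields.BalabanUV.T4Continuum.BlockMultiplication (siteMul siteMul_apply)
open Summit.QuantumFields.BalabanUV.T4Continuum.ColourCovariantLaplacian (covDc)
open Summit.QuantumFields.BalabanUV.T4Continuum.CovariantBlockAveraging (transport ContourSystem Qcov)
open Summit.QuantumFields.BalabanUV.T4Continuum.SubstrateBackgroundTransporters
open Summit.QuantumFields.BalabanUV.T4Continuum.SubstrateTransporterSpecies
open Summit.QuantumFields.BalabanUV.T4Continuum.SubstrateTransporterSpeciesHolo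

/-! ## §1 Entrywise analyticity for matrix-valued maps (scope `Matrix.Norms.L2Operator`) -/

section Entry

variable {E F F' : Type*} [NormedAddCommGroup E] [NormedSpace ℂ E] [NormedAddCommGroup F] [NormedSpace ℂ F] [NormedAddCommGroup F']
  [NormedSpace ℂ F'] {l m n : Type*} [Fintype l] [Fintype m] [Fintype n] [DecidableEq m] [DecidableEq n]

/-- [folklore] Post-composition with a continuous linear equivalence preserves and reflects analyticity at a point. -/
theorem cle_comp_analyticAt_iff (e : F ≃L[ℂ] F') {f : E → F} {x : E} : AnalyticAt ℂ (⇑e ∘ f) x ↔ AnalyticAt ℂ f x := by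
  refine ⟨fun h => ?_, fun h => ((e : F →L[ℂ] F').analyticAt _).comp h⟩
  have h' := ((e.symm : F' →L[ℂ] F).analyticAt _).comp h
  have hfe : (⇑(e.symm : F' →L[ℂ] F) ∘ (⇑e ∘ f)) = f := funext fun y => e.symm_apply_apply (f y)
  rwa [hfe] at h'

omit [DecidableEq m] in
/-- [folklore] **A MATRIX-VALUED MAP IS ANALYTIC AT A POINT IFF EVERY ENTRY IS** (here in the scoped `L2Operator` norm). -/
theorem analyticAt_matrix_iff {G : E → Matrix m n ℂ} {x : E} : AnalyticAt ℂ G x ↔ ∀ i j, AnalyticAt ℂ (fun y => G y i j) x := by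
  rw [← cle_comp_analyticAt_iff (entryCLE (m := m) (n := n))]
  have h1 : AnalyticAt ℂ (⇑(entryCLE (m := m) (n := n)) ∘ G) x ↔ ∀ i, AnalyticAt ℂ (fun y => G y i) x :=
    analyticAt_pi_iff (f := fun i y => G y i)
  rw [h1]
  refine forall_congr' fun i => ?_
  exact analyticAt_pi_iff (f := fun j y => G y i j)

/-- [folklore] **PRODUCTS OF ANALYTIC MATRIX MAPS ARE ANALYTIC** — any (rectangular) shapes (entries: finite sums of products). -/
theorem analyticAt_matrix_mul {G : E → Matrix l m ℂ} {H : E → Matrix m n ℂ} {x : E} (hG : AnalyticAt ℂ G x) (hH : AnalyticAt ℂ H x) :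
    AnalyticAt ℂ (fun y => G y * H y) x := by
  rw [analyticAt_matrix_iff] at hG hH ⊢
  intro i j
  simp only [Matrix.mul_apply]
  exact Finset.analyticAt_fun_sum _ fun k _ => (hG i k).fun_mul (hH k j)

/-- [folklore] **THE INVERSE OF AN ANALYTIC SQUARE-MATRIX MAP IS ANALYTIC AT A POINT WHERE THE DETERMINANT IS A UNIT** (`M⁻¹ = Ring.inverse M`;
`analyticAt_inverse` on the complete normed algebra `Matrix n n ℂ`). -/
theorem analyticAt_matrix_inv {G : E → Matrix n n ℂ} {x : E} (hG : AnalyticAt ℂ G x) (h : IsUnit (G x).det) :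
    AnalyticAt ℂ (fun y => (G y)⁻¹) x := by
  simp only [Matrix.nonsing_inv_eq_ringInverse]
  obtain ⟨u, hu⟩ := (Matrix.isUnit_iff_isUnit_det _).mpr h
  exact (analyticAt_inverse (𝕜 := ℂ) u).fun_comp_of_eq hG hu.symm

end Entry

/-! ## §2 The one-level two-sided species at a point, along pointwise-analytic transporter data -/

section OneLevel

variable {E : Type*} [NormedAddCommGroup E] [NormedSpace ℂ E] {x : E} {d : ℕ} (Nf : Fin d → ℕ) [hNf : ∀ μ, NeZero (Nf μ)]
  {o : Type*} [Fintype o] [DecidableEq o] {R S : E → Fin d → (Tor Nf × Fin d → Matrix o o ℂ)}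

omit hNf in
/-- [folklore] Parallel transport along a bond list is analytic in analytic transporter data (a finite product). -/
theorem analyticAt_transport (hR : ∀ ν i, AnalyticAt ℂ (fun y => R y ν i) x) (μ : Fin d) (Γ : List (Tor Nf × Fin d)) :
    AnalyticAt ℂ (fun y => transport Nf (R y) μ Γ) x := by
  induction Γ with
  | nil => simp only [transport, List.map_nil, List.prod_nil]; exact analyticAt_const
  | cons b Γ ih =>
      simp only [transport, List.map_cons, List.prod_cons] at ih ⊢
      exact (hR b.2 (b.1, μ)).fun_mul ih

omit hNf in
/-- [folklore] The adjoint (reversed) transport is analytic in analytic `S`. -/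
theorem analyticAt_transportA (hS : ∀ ν i, AnalyticAt ℂ (fun y => S y ν i) x) (μ : Fin d) (Γ : List (Tor Nf × Fin d)) :
    AnalyticAt ℂ (fun y => transportA Nf (S y) μ Γ) x := by
  induction Γ with
  | nil => simp only [transportA_nil]; exact analyticAt_const
  | cons b Γ ih =>
      have h : ∀ y, transportA Nf (S y) μ (b :: Γ) = transportA Nf (S y) μ Γ * S y b.2 (b.1, μ) := fun y => by
        rw [← List.singleton_append, transportA_append]; simp [transportA]
      simp only [h]
      exact ih.fun_mul (hS b.2 (b.1, μ))

/-- [folklore] Site-wise colour multiplication is analytic in analytic colour matrices. -/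
theorem analyticAt_siteMul {ι : Type*} [Fintype ι] [DecidableEq ι] {w : E → ι → Matrix o o ℂ} (hw : ∀ i, AnalyticAt ℂ (fun y => w y i) x) :
    AnalyticAt ℂ (fun y => siteMul (w y)) x := by
  rw [analyticAt_matrix_iff]
  intro a b
  simp only [siteMul_apply]
  split_ifs
  · exact analyticAt_matrix_iff.1 (hw a.1) a.2 b.2
  · exact analyticAt_const

/-- [folklore] `covDc c R ν` is analytic along analytic transporters (affine in `R ν`). -/
theorem analyticAt_covDc (hR : ∀ ν i, AnalyticAt ℂ (fun y => R y ν i) x) (c : ℂ) (ν : Fin d) :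
    AnalyticAt ℂ (fun y => covDc Nf c (R y) ν) x := by
  unfold covDc
  exact (((analyticAt_siteMul (hR ν)).fun_mul analyticAt_const).fun_sub analyticAt_const).fun_const_smul

/-- [folklore] `covDcA c S ν` is analytic along analytic `S` (affine in `S ν`). -/
theorem analyticAt_covDcA (hS : ∀ ν i, AnalyticAt ℂ (fun y => S y ν i) x) (c : ℂ) (ν : Fin d) :
    AnalyticAt ℂ (fun y => covDcA Nf c (S y) ν) x := by
  unfold covDcA
  exact ((analyticAt_const.fun_mul (analyticAt_siteMul (hS ν))).fun_sub analyticAt_const).fun_const_smul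

/-- [folklore] The two-sided covariant Laplacian `covLapT c R S` is analytic along analytic `(R, S)` (bilinear). -/
theorem analyticAt_covLapT (hR : ∀ ν i, AnalyticAt ℂ (fun y => R y ν i) x) (hS : ∀ ν i, AnalyticAt ℂ (fun y => S y ν i) x) (c : ℂ) :
    AnalyticAt ℂ (fun y => covLapT Nf c (R y) (S y)) x := by
  unfold covLapT
  exact Finset.analyticAt_fun_sum _ fun ν _ => (analyticAt_covDcA Nf hS c ν).fun_mul (analyticAt_covDc Nf hR c ν)

end OneLevel

section Block

variable {E : Type*} [NormedAddCommGroup E] [NormedSpace ℂ E] {x : E} {d : ℕ} (n : ℕ) [NeZero n] (M : Fin d → ℕ)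
  [hM : ∀ μ, NeZero (M μ)] {o : Type*} [Fintype o] [DecidableEq o] {R S : E → Fin d → (Tor (fine n M) × Fin d → Matrix o o ℂ)}

/-- [folklore] The covariant block averaging `Qcov Γ R` is analytic along analytic transporters (entries = weighted transports). -/
theorem analyticAt_Qcov (hR : ∀ ν i, AnalyticAt ℂ (fun y => R y ν i) x) (Γ : ContourSystem d n M) :
    AnalyticAt ℂ (fun y => Qcov n M Γ (R y)) x := by
  rw [analyticAt_matrix_iff]
  intro b i
  simp only [Qcov]
  split_ifs
  · refine Finset.analyticAt_fun_sum _ fun j _ => Finset.analyticAt_fun_sum _ fun t _ => ?_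
    split_ifs
    · exact analyticAt_const.fun_mul (analyticAt_matrix_iff.1 (analyticAt_transport (fine n M) hR b.1.2 (Γ b.1.1 j b.1.2 t)) b.2 i.2)
    · exact analyticAt_const
  · exact analyticAt_const

/-- [folklore] The adjoint block averaging `QcovA Γ S` is analytic along analytic `S`. -/
theorem analyticAt_QcovA (hS : ∀ ν i, AnalyticAt ℂ (fun y => S y ν i) x) (Γ : ContourSystem d n M) :
    AnalyticAt ℂ (fun y => QcovA n M Γ (S y)) x := by
  rw [analyticAt_matrix_iff]
  intro i b
  simp only [QcovA]
  split_ifs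
  · refine Finset.analyticAt_fun_sum _ fun j _ => Finset.analyticAt_fun_sum _ fun t _ => ?_
    split_ifs
    · exact analyticAt_const.fun_mul (analyticAt_matrix_iff.1 (analyticAt_transportA (fine n M) hS b.1.2 (Γ b.1.1 j b.1.2 t)) i.2 b.2)
    · exact analyticAt_const
  · exact analyticAt_const

/-- [folklore] **THE TWO-SIDED FLUCTUATION OPERATOR `deltaQT c a Γ R S` IS ANALYTIC ALONG ANALYTIC DATA `(R, S)`** (polynomial). -/
theorem analyticAt_deltaQT (hR : ∀ ν i, AnalyticAt ℂ (fun y => R y ν i) x) (hS : ∀ ν i, AnalyticAt ℂ (fun y => S y ν i) x)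
    (c : ℂ) (a : ℝ) (Γ : ContourSystem d n M) : AnalyticAt ℂ (fun y => deltaQT n M c a Γ (R y) (S y)) x := by
  unfold deltaQT
  exact (analyticAt_covLapT (fine n M) hR hS c).fun_add
    (analyticAt_matrix_mul (analyticAt_QcovA n M hS Γ) (analyticAt_Qcov n M hR Γ)).fun_const_smul

/-- [folklore] **THE TWO-SIDED GREEN'S FUNCTION IS ANALYTIC OFF THE SINGULAR SET**: at a point where `det (deltaQT …)` is a unit. -/
theorem analyticAt_greenT (hR : ∀ ν i, AnalyticAt ℂ (fun y => R y ν i) x) (hS : ∀ ν i, AnalyticAt ℂ (fun y => S y ν i) x)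
    {c : ℂ} {a : ℝ} {Γ : ContourSystem d n M} (hdet : IsUnit (deltaQT n M c a Γ (R x) (S x)).det) :
    AnalyticAt ℂ (fun y => greenT n M c a Γ (R y) (S y)) x := by
  unfold greenT
  exact analyticAt_matrix_inv (analyticAt_deltaQT n M hR hS c a Γ) hdet

/-- [folklore] **THE TWO-SIDED UNIT-LATTICE COVARIANCE `unitCovT` IS ANALYTIC OFF THE SINGULAR SET OF `deltaQT`.** -/
theorem analyticAt_unitCovT (hR : ∀ ν i, AnalyticAt ℂ (fun y => R y ν i) x) (hS : ∀ ν i, AnalyticAt ℂ (fun y => S y ν i) x)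
    {c : ℂ} {a : ℝ} {Γ : ContourSystem d n M} (hdet : IsUnit (deltaQT n M c a Γ (R x) (S x)).det) (sc : ℂ) :
    AnalyticAt ℂ (fun y => unitCovT n M c a sc Γ (R y) (S y)) x := by
  unfold unitCovT
  exact (analyticAt_matrix_mul (analyticAt_matrix_mul (analyticAt_Qcov n M hR Γ) (analyticAt_greenT n M hR hS hdet))
    (analyticAt_QcovA n M hS Γ)).fun_const_smul

end Block

/-! ## §3 The exponential chart is analytic everywhere -/

section Chart

variable {d : ℕ} {o : Type*} [Fintype o] [DecidableEq o] {ι : Type*} [Fintype ι]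

/-- [folklore] The matrix exponential is analytic at every point of the complete normed algebra `Matrix o o ℂ`. -/
theorem analyticAt_mexp (A : Matrix o o ℂ) : AnalyticAt ℂ (fun B : Matrix o o ℂ => NormedSpace.exp B) A :=
  NormedSpace.exp_analytic (𝕂 := ℂ) A

/-- [folklore] A bond coordinate `A ↦ A ν i` of one-level chart data is analytic (a continuous linear projection). -/
theorem analyticAt_coord (ν : Fin d) (i : ι) (A₀ : Fin d → ι → Matrix o o ℂ) :
    AnalyticAt ℂ (fun A : Fin d → ι → Matrix o o ℂ => A ν i) A₀ :=
  (analyticAt_pi_iff (f := fun i (A : Fin d → ι → Matrix o o ℂ) => A ν i)).1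
    ((analyticAt_pi_iff (f := fun ν (A : Fin d → ι → Matrix o o ℂ) => A ν)).1 analyticAt_id ν) i

/-- [folklore] **THE EXPONENTIAL CHART IS ANALYTIC EVERYWHERE**: `A ↦ expChart R⁰ A ν i = exp (A ν i) · R⁰ ν i`. -/
theorem analyticAt_expChart (R₀ : Fin d → ι → Matrix o o ℂ) (ν : Fin d) (i : ι) (A₀ : Fin d → ι → Matrix o o ℂ) :
    AnalyticAt ℂ (fun A : Fin d → ι → Matrix o o ℂ => expChart R₀ A ν i) A₀ := by
  simp only [expChart_apply]
  exact ((analyticAt_mexp _).fun_comp (analyticAt_coord ν i A₀)).fun_mul analyticAt_const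

/-- [folklore] … and so is the inverse-side chart `A ↦ expChartInv R⁰ A ν i = (R⁰ ν i)⁻¹ · exp (−A ν i)`. -/
theorem analyticAt_expChartInv (R₀ : Fin d → ι → Matrix o o ℂ) (ν : Fin d) (i : ι) (A₀ : Fin d → ι → Matrix o o ℂ) :
    AnalyticAt ℂ (fun A : Fin d → ι → Matrix o o ℂ => expChartInv R₀ A ν i) A₀ := by
  simp only [expChartInv_apply]
  exact analyticAt_const.fun_mul ((analyticAt_mexp _).fun_comp (analyticAt_coord ν i A₀).fun_neg)

end Chart

/-! ## §4 The tower chart: analyticity of record on the regular set -/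

section Tower

variable (P : Params) {o : Type*} [Fintype o] [DecidableEq o]

/-- [folklore] The level-`k` projection of tower data is analytic (a continuous linear projection). -/
theorem analyticAt_level (k : Fin (P.K + 1)) (A₀ : TowerData P o) : AnalyticAt ℂ (fun A : TowerData P o => A k) A₀ :=
  (analyticAt_pi_iff (f := fun k (A : TowerData P o) => A k)).1 analyticAt_id k

/-- [folklore] Every bond transporter of the tower chart `expChartT` is analytic on `TowerData P o`. -/
theorem analyticAt_expChartT_apply (R₀ : TowerData P o) (k : Fin (P.K + 1)) (ν : Fin P.d) (i : Tor (fine (lev P.L k) (unitMod P)) × Fin P.d)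
    (A₀ : TowerData P o) : AnalyticAt ℂ (fun A : TowerData P o => expChartT P R₀ A k ν i) A₀ :=
  have h := (analyticAt_expChart (R₀ k) ν i (A₀ k)).comp (f := fun A : TowerData P o => A k) (analyticAt_level P k A₀)
  h

/-- [folklore] Every bond matrix of the inverse-side tower chart `expChartInvT` is analytic on `TowerData P o`. -/
theorem analyticAt_expChartInvT_apply (R₀ : TowerData P o) (k : Fin (P.K + 1)) (ν : Fin P.d)
    (i : Tor (fine (lev P.L k) (unitMod P)) × Fin P.d) (A₀ : TowerData P o) :
    AnalyticAt ℂ (fun A : TowerData P o => expChartInvT P R₀ A k ν i) A₀ :=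
  have h := (analyticAt_expChartInv (R₀ k) ν i (A₀ k)).comp (f := fun A : TowerData P o => A k) (analyticAt_level P k A₀)
  h

variable (c : ℂ) (a : ℝ) (Γ : (k : ℕ) → ContourSystem P.d (lev P.L k) (unitMod P))

/-- [folklore] The level-`k` fluctuation operator along the tower chart is analytic at every chart point (polynomial ∘ exp). -/
theorem analyticAt_deltaQT_expChartT (R₀ : TowerData P o) (k : Fin (P.K + 1)) (A₀ : TowerData P o) : AnalyticAt ℂ
    (fun A : TowerData P o => deltaQT (lev P.L k) (unitMod P) c a (Γ k) (expChartT P R₀ A k) (expChartInvT P R₀ A k)) A₀ :=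
  analyticAt_deltaQT (lev P.L k) (unitMod P) (fun ν i => analyticAt_expChartT_apply P R₀ k ν i A₀)
    (fun ν i => analyticAt_expChartInvT_apply P R₀ k ν i A₀) c a (Γ k)

/-- [folklore] **THE LEVEL-`k` TWO-SIDED COVARIANCE ALONG THE TOWER CHART IS ANALYTIC ON THE LEVEL-`k` REGULAR SET** (matrix-valued). -/
theorem analyticOnNhd_unitCovT_expChartT (R₀ : TowerData P o) (k : Fin (P.K + 1)) (sc : ℂ) : AnalyticOnNhd ℂ
    (fun A : TowerData P o => unitCovT (lev P.L k) (unitMod P) c a sc (Γ k) (expChartT P R₀ A k) (expChartInvT P R₀ A k))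
    (regularSetAt P c a Γ R₀ k) :=
  fun A₀ hA₀ => analyticAt_unitCovT (lev P.L k) (unitMod P) (fun ν i => analyticAt_expChartT_apply P R₀ k ν i A₀)
    (fun ν i => analyticAt_expChartInvT_apply P R₀ k ν i A₀) hA₀ sc

variable (s : ℕ → ℂ)

/-- [folklore] **ANALYTICITY OF RECORD: EVERY ENTRY OF THE COVARIANCE FAMILY `covAtT` READ ALONG THE TOWER CHART IS `AnalyticOnNhd ℂ` ON
THE REGULAR SET** — every level `k` (levels `k > K` read `0`), every slot `t`, every pair of unit-lattice indices.  [Balaban1987RG1] (1.17)–(1.18)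
∕ (4.4) and [Balaban1985BackgroundPropagators] Sect. B are the KIND-level warrant only. -/
theorem analyticOnNhd_covAtT_expChart (R₀ : TowerData P o) (k : ℕ) {T : Type*} (t : T) (b b' : (Tor (unitMod P) × Fin P.d) × o) :
    AnalyticOnNhd ℂ (fun A : TowerData P o => covAtT P c a s Γ (expChartT P R₀ A) (expChartInvT P R₀ A) k t b b')
      (regularSet P c a Γ R₀) := by
  unfold covAtT
  by_cases hk : k ≤ P.K
  · simp only [dif_pos hk]
    intro A₀ hA₀
    exact analyticAt_matrix_iff.1 (analyticOnNhd_unitCovT_expChartT P c a Γ R₀ ⟨k, Nat.lt_succ_of_le hk⟩ (s k) A₀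
      (Set.mem_iInter.1 hA₀ _)) b b'
  · simp only [dif_neg hk]
    exact fun _ _ => analyticAt_const

/-- [folklore] **THE BALL FORM** (the shape of `T4BetaReadOutLipschitz.Probes.Analytic` and, via `AnalyticOnNhd.differentiableOn`, of NE9's
`analyticClass`): a regular centre has a chart ball on which every entry of `covAtT` along the chart is analytic — `ρ` from openness, NOT
computed (quantitative radius = VECJ-H on the J-road). -/
theorem exists_ball_analyticOnNhd_covAtT {R₀ : TowerData P o} (h0 : (0 : TowerData P o) ∈ regularSet P c a Γ R₀) :
    ∃ ρ > 0, ∀ (k : ℕ) {T : Type*} (t : T) (b b' : (Tor (unitMod P) × Fin P.d) × o),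
      AnalyticOnNhd ℂ (fun A : TowerData P o => covAtT P c a s Γ (expChartT P R₀ A) (expChartInvT P R₀ A) k t b b')
        (Metric.ball (0 : TowerData P o) ρ) := by
  obtain ⟨ρ, hρ, hsub⟩ := exists_ball_subset_regularSet P c a Γ h0
  exact ⟨ρ, hρ, fun k _ t b b' => (analyticOnNhd_covAtT_expChart P c a Γ s R₀ k t b b').mono hsub⟩

end Tower

end Summit.QuantumFields.BalabanUV.T4Continuum.SubstrateTransporterSpeciesAnalytic

end
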